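import Mathlib
import Summits.ResolutionOfSingularities.ResolutionOfSingularities.Theorems.RadicialJungCleanModelsCleanLU3ArcDischarge
import Literature.AlgebraicGeometry.Resolution.TranscendenceDefect
import HarnessLib

/-!
# Census (res-B-lens-5 g7, lens 5 «transfer from the solved sibling: Cossart–Piltant 2019»): typed TARGETS and kernel
# certificates for the ARC class of `stub_cleanLU3Defect` over EVERY ground field

Crux of record: stmt-ResolutionOfSingularities-0549 `Theses.Descent.DescentPerfectToAll` (FIXED; nothing here restates it).
This file is 15917-side bookkeeping for the lead `res-B-lead-1` g3 (skeleton `Cruxes/CleanModels/Lines/Sketch.lean` rev 20,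
sha16 0ed627d06d47d46d).  Hand proofs: `Cruxes/DescentPerfectToAll/CLASSA-allfields-potential-lens5.md` (commit e709ae1b8c5f).
bears_on: LADDER-RESOLUTION:B · [OURS · CANDIDATE] counted 0; nothing here proves resolution in characteristic `p`; no `sorry`,
no new axioms; statements (`def … : Prop`) + kernel-checked implications only.

Contents.
* `ArcConcl` — the common conclusion of the arc stubs (verbatim).
* `AbsDerivationMovesAt p` — LEMMA D-abs: every `g₀ ∉ K^p` is moved by an ABSOLUTE derivation of `K` preserving the finitely
  generated `A` up to a denominator (CP 2019 Prop. 2.50, p.315: absolute `p`-basis of a regular local ring essentially of finite type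
  over an arbitrary `k`, after a FINITE exchange).  Strictly stronger than `stub_derivation_of_not_mem_adjoin_pow`.
* `ArcPotentialAt p` — THEOREM P: the signature of the LANDED ✓ `cleanLU3Defect_of_discrete_of_finiteResidue` with the
  finite-residue-tower hypothesis DELETED (the potential argument is residue-field-blind).
* Certificates (no `sorry`): `derivationStub_of_absDerivation`, `arcConstants_of_absDerivation` (uses the landed theorem BY NAME),
  `arcInfinite_of_potential_of_absDerivation`, `arcConstants_of_potential_of_absDerivation`,
  `cleanLU3DefectDiscrete_of_potential_of_absDerivation` (the whole discrete branch of `cleanLU3Defect_of_stubs` from the two targets,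
  with NO case split on the residue tower or on `g₀ ∈ k[K^p]`).
-/

noncomputable section

set_option linter.dupNamespace false

open IsLocalRing
open Literature.AlgebraicGeometry.Resolution

namespace Summit.ResolutionOfSingularities.ResolutionOfSingularities.Cruxes.DescentPerfectToAll.CpSibling.ArcPotential

/-- The common conclusion «CONCL» of the arc stubs of `Sketch.lean` rev 20 (verbatim): a finitely generated `A' ⊇ A` inside `O`,
regular at the centre of `O`, and a non-trivial representative of the `K^p`-line of `g₀` in loose clean form (1) ∨ (2) ∨ (3) there.
[folklore] -/
def ArcConcl (p : ℕ) (k K : Type) [Field k] [Field K] [Algebra k K] (O : ValuationSubring K) (A : Subalgebra k K)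
    (g₀ : K) : Prop :=
  ∃ (A' : Subalgebra k K), A'.toSubring ≤ O.toSubring ∧ A ≤ A' ∧ A'.FG ∧
    ∃ (_ : IsRegularLocalRing (locAtCentre A'.toSubring O)) (c : Fin p → K), (∃ j : Fin p, (j : ℕ) ≠ 0 ∧ c j ≠ 0) ∧
    ((∃ (d m : ℕ) (hmd : m ≤ d) (t : Fin d → ↥(locAtCentre A'.toSubring O)) (a : Fin m → ℕ) (u : ↥(locAtCentre A'.toSubring O)), IsUnit u ∧
    Ideal.span (Set.range t) = IsLocalRing.maximalIdeal ↥(locAtCentre A'.toSubring O) ∧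
    ringKrullDim ↥(locAtCentre A'.toSubring O) = (d : WithBot ℕ∞) ∧ 0 < m ∧ (∀ i, ¬ p ∣ a i) ∧
    (∑ j : Fin p, c j ^ p * g₀ ^ (j : ℕ)) = (u : K) * ∏ i : Fin m, ((t (Fin.castLE hmd i) : ↥(locAtCentre A'.toSubring O)) : K) ^ (a i)) ∨
    (∃ u : ↥(locAtCentre A'.toSubring O), IsUnit u ∧ (∑ j : Fin p, c j ^ p * g₀ ^ (j : ℕ)) = (u : K) ∧
    ∀ c' : ↥(locAtCentre A'.toSubring O), u - c' ^ p ∉ IsLocalRing.maximalIdeal ↥(locAtCentre A'.toSubring O)) ∨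
    (∃ s c' : ↥(locAtCentre A'.toSubring O), (∑ j : Fin p, c j ^ p * g₀ ^ (j : ℕ)) = (s : K) ∧
    s - c' ^ p ∈ IsLocalRing.maximalIdeal ↥(locAtCentre A'.toSubring O) ∧
    s - c' ^ p ∉ IsLocalRing.maximalIdeal ↥(locAtCentre A'.toSubring O) ^ 2))

/-- TARGET «LEMMA D-abs» (field theory, size M; transfer from the sibling): for a finitely generated `k`-algebra `A` with fraction
field `K` and `g₀ ∉ K^p` there is an ABSOLUTE derivation `D` of `K` (over `ℤ`; it need not kill `k`) with `D g₀ ≠ 0` and `s ≠ 0`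
with `s • D (A) ⊆ A`.  Proof on paper: CP 2019 Prop. 2.50 (absolute `p`-basis `(λ'), u₁, …, u_n` of a regular `A_𝔮` obtained from a
`p`-basis of `k` by a FINITE exchange `Φ`; the dual derivation `∂_γ` at a coordinate `γ` where `d(b^p g₀) ≠ 0` preserves `A_𝔮`;
denominators are finite because `Φ` and the generators of `A` are), memo §1.  For `[k : k^p] < ∞` it is immediate.
[cite: paper:cossart2019-resolution-singularities-arithmetical-threefolds p.315, Prop. 2.50] -/
def AbsDerivationMovesAt (p : ℕ) : Prop :=
  ∀ (k : Type) [Field k] [CharP k p] (K : Type) [Field K] [Algebra k K] (A : Subalgebra k K), A.FG → IsFractionRing A K →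
    ∀ g₀ : K, (∀ c : K, c ^ p ≠ g₀) →
    ∃ (D : Derivation ℤ K K) (s : K), s ≠ 0 ∧ (∀ y : K, y ∈ A → s * D y ∈ A) ∧ D g₀ ≠ 0

/-- TARGET «THEOREM P» (the potential argument, size M–L, all ring-level): the statement of the LANDED
✓ `cleanLU3Defect_of_discrete_of_finiteResidue` WITHOUT its finite-residue-tower hypothesis — clean LU along a DISCRETE RANK-ONE `O`
for `g₀` with no best `p`-th-power approximation, given a derivation of `K` moving `g₀` and preserving `A` up to a denominator, for an
ARBITRARY residue tower and ground field.  Proof on paper (memo §2): with `E_N := π^{N−N₀}E` one has `E_N h = π^{e_N}·unit`; for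
`c ∈ R N` and `h − c^p = π^a F`: (P0) `v(h − c^p) ∈ pℤ`, (P1) `a ≤ e_N`, (P2) `a ≤ m−2 ∧ ord F = 1 ⇒` form (1)/(3), (P3) unit case ⇒
form (2) or update `c += π^{m/p}β`, (P4) blow-up raises `a` by `≥ ord F`, (P5) `Π_N := e_N − a` drops every two blow-ups. [folklore] -/
def ArcPotentialAt (p : ℕ) : Prop :=
  ∀ (k : Type) [Field k] [CharP k p] (K : Type) [Field K] [Algebra k K]
    (O : ValuationSubring K) (A : Subalgebra k K), A.toSubring ≤ O.toSubring → A.FG → IsFractionRing A K →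
    ringKrullDim A ≤ 3 → IsRegularLocalRing (locAtCentre A.toSubring O) →
    ringKrullDim (locAtCentre A.toSubring O) = 3 →
    (∀ (T : Subring K) (hT : T ≤ O.toSubring), A.toSubring ≤ T → (subringCentre T O hT).IsMaximal) →
    ∀ g₀ : K, (∀ c : K, c ^ p ≠ g₀) →
    (∀ f₀ : K, ∃ f₁ : K, O.valuation (g₀ - f₁ ^ p) < O.valuation (g₀ - f₀ ^ p)) →
    (∀ hk : ∀ c : k, algebraMap k K c ∈ O, transcendenceDefect k O hk ≠ 0) →
    (∃ π : K, π ≠ 0 ∧ (∀ x : K, O.valuation x < 1 → O.valuation x ≤ O.valuation π) ∧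
      (∀ x : K, x ≠ 0 → ∃ n : ℕ, O.valuation π ^ n ≤ O.valuation x)) →
    (∃ (D : Derivation ℤ K K) (s : K), s ≠ 0 ∧ (∀ y : K, y ∈ A → s * D y ∈ A) ∧ D g₀ ≠ 0) →
    ArcConcl p k K O A g₀

/-! ## Certificates -/

/-- `c^p` lies in the `k`-subalgebra generated by the `p`-th powers; hence `g₀ ∉ k[K^p] ⇒ ∀ c, c^p ≠ g₀`. [folklore] -/
theorem forall_pow_ne_of_not_mem_adjoin {p : ℕ} {k K : Type} [Field k] [Field K] [Algebra k K] {g₀ : K}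
    (h : g₀ ∉ Algebra.adjoin k (Set.range fun y : K => y ^ p)) : ∀ c : K, c ^ p ≠ g₀ := by
  intro c hc
  apply h
  rw [← hc]
  exact Algebra.subset_adjoin ⟨c, rfl⟩

/-- CERTIFICATE: LEMMA D-abs ⇒ `stub_derivation_of_not_mem_adjoin_pow` (its statement at a fixed prime `p`, verbatim). [folklore] -/
theorem derivationStub_of_absDerivation {p : ℕ} (hD : AbsDerivationMovesAt p) :
    ∀ (k : Type) [Field k] [CharP k p] (K : Type) [Field K] [Algebra k K] (A : Subalgebra k K), A.FG → IsFractionRing A K →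
    ∀ g₀ : K, g₀ ∉ Algebra.adjoin k (Set.range fun y : K => y ^ p) →
    ∃ (D : Derivation ℤ K K) (s : K), s ≠ 0 ∧ (∀ y : K, y ∈ A → s * D y ∈ A) ∧ D g₀ ≠ 0 := by
  intro k _ _ K _ _ A hAfg hfrac g₀ hmem
  exact hD k K A hAfg hfrac g₀ (forall_pow_ne_of_not_mem_adjoin hmem)

/-- CERTIFICATE: LEMMA D-abs ALONE ⇒ `stub_cleanLU3DefectArcConstants` (verbatim at a fixed prime), through the LANDED
✓ `cleanLU3Defect_of_discrete_of_finiteResidue`, which already accepts an absolute `Derivation ℤ K K`; the hypothesis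
`g₀ ∈ k[K^p]` is not even used. [folklore] -/
theorem arcConstants_of_absDerivation {p : ℕ} (hD : AbsDerivationMovesAt p) : p.Prime →
    ∀ (k : Type) [Field k] [CharP k p] (K : Type) [Field K] [Algebra k K]
    (O : ValuationSubring K) (A : Subalgebra k K), A.toSubring ≤ O.toSubring → A.FG → IsFractionRing A K →
    ringKrullDim A ≤ 3 → IsRegularLocalRing (locAtCentre A.toSubring O) →
    ringKrullDim (locAtCentre A.toSubring O) = 3 →
    (∀ (T : Subring K) (hT : T ≤ O.toSubring), A.toSubring ≤ T → (subringCentre T O hT).IsMaximal) →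
    ∀ g₀ : K, (∀ c : K, c ^ p ≠ g₀) →
    (∀ f₀ : K, ∃ f₁ : K, O.valuation (g₀ - f₁ ^ p) < O.valuation (g₀ - f₀ ^ p)) →
    (∀ hk : ∀ c : k, algebraMap k K c ∈ O, transcendenceDefect k O hk ≠ 0) →
    (∃ π : K, π ≠ 0 ∧ (∀ x : K, O.valuation x < 1 → O.valuation x ≤ O.valuation π) ∧
      (∀ x : K, x ≠ 0 → ∃ n : ℕ, O.valuation π ^ n ≤ O.valuation x)) →
    (∃ S : Finset K, (↑S : Set K) ⊆ O ∧
      ∀ y : K, y ∈ O → ∃ r : K, r ∈ Subring.closure ((locAtCentre A.toSubring O : Set K) ∪ ↑S) ∧ O.valuation (y - r) < 1) →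
    g₀ ∈ Algebra.adjoin k (Set.range fun y : K => y ^ p) →
    ArcConcl p k K O A g₀ := by
  intro hp k _ _ K _ _ O A hAO hAfg hfrac hdimA hreg hdim3 hzd g₀ hg₀ hdefect htd hdisc hres _
  exact Summit.ResolutionOfSingularities.ResolutionOfSingularities.Theorems.RadicialJung.CleanModels.cleanLU3Defect_of_discrete_of_finiteResidue
    p hp k K O A hAO hAfg hfrac hdimA hreg hdim3 hzd g₀ hg₀ hdefect htd hdisc hres (hD k K A hAfg hfrac g₀ hg₀)

/-- CERTIFICATE: THEOREM P + LEMMA D-abs ⇒ `stub_cleanLU3DefectArcInfinite` (verbatim at a fixed prime; the negated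
finite-residue-tower hypothesis is simply dropped). [folklore] -/
theorem arcInfinite_of_potential_of_absDerivation {p : ℕ} (hP : ArcPotentialAt p) (hD : AbsDerivationMovesAt p) : p.Prime →
    ∀ (k : Type) [Field k] [CharP k p] (K : Type) [Field K] [Algebra k K]
    (O : ValuationSubring K) (A : Subalgebra k K), A.toSubring ≤ O.toSubring → A.FG → IsFractionRing A K →
    ringKrullDim A ≤ 3 → IsRegularLocalRing (locAtCentre A.toSubring O) →
    ringKrullDim (locAtCentre A.toSubring O) = 3 →
    (∀ (T : Subring K) (hT : T ≤ O.toSubring), A.toSubring ≤ T → (subringCentre T O hT).IsMaximal) →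
    ∀ g₀ : K, (∀ c : K, c ^ p ≠ g₀) →
    (∀ f₀ : K, ∃ f₁ : K, O.valuation (g₀ - f₁ ^ p) < O.valuation (g₀ - f₀ ^ p)) →
    (∀ hk : ∀ c : k, algebraMap k K c ∈ O, transcendenceDefect k O hk ≠ 0) →
    (∃ π : K, π ≠ 0 ∧ (∀ x : K, O.valuation x < 1 → O.valuation x ≤ O.valuation π) ∧
      (∀ x : K, x ≠ 0 → ∃ n : ℕ, O.valuation π ^ n ≤ O.valuation x)) →
    ¬ (∃ S : Finset K, (↑S : Set K) ⊆ O ∧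
      ∀ y : K, y ∈ O → ∃ r : K, r ∈ Subring.closure ((locAtCentre A.toSubring O : Set K) ∪ ↑S) ∧ O.valuation (y - r) < 1) →
    ArcConcl p k K O A g₀ := by
  intro _ k _ _ K _ _ O A hAO hAfg hfrac hdimA hreg hdim3 hzd g₀ hg₀ hdefect htd hdisc _
  exact hP k K O A hAO hAfg hfrac hdimA hreg hdim3 hzd g₀ hg₀ hdefect htd hdisc (hD k K A hAfg hfrac g₀ hg₀)

/-- CERTIFICATE: THEOREM P + LEMMA D-abs ⇒ `stub_cleanLU3DefectArcConstants` as well (second route, ignoring both the residue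
hypothesis and `g₀ ∈ k[K^p]`). [folklore] -/
theorem arcConstants_of_potential_of_absDerivation {p : ℕ} (hP : ArcPotentialAt p) (hD : AbsDerivationMovesAt p) : p.Prime →
    ∀ (k : Type) [Field k] [CharP k p] (K : Type) [Field K] [Algebra k K]
    (O : ValuationSubring K) (A : Subalgebra k K), A.toSubring ≤ O.toSubring → A.FG → IsFractionRing A K →
    ringKrullDim A ≤ 3 → IsRegularLocalRing (locAtCentre A.toSubring O) →
    ringKrullDim (locAtCentre A.toSubring O) = 3 →
    (∀ (T : Subring K) (hT : T ≤ O.toSubring), A.toSubring ≤ T → (subringCentre T O hT).IsMaximal) →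
    ∀ g₀ : K, (∀ c : K, c ^ p ≠ g₀) →
    (∀ f₀ : K, ∃ f₁ : K, O.valuation (g₀ - f₁ ^ p) < O.valuation (g₀ - f₀ ^ p)) →
    (∀ hk : ∀ c : k, algebraMap k K c ∈ O, transcendenceDefect k O hk ≠ 0) →
    (∃ π : K, π ≠ 0 ∧ (∀ x : K, O.valuation x < 1 → O.valuation x ≤ O.valuation π) ∧
      (∀ x : K, x ≠ 0 → ∃ n : ℕ, O.valuation π ^ n ≤ O.valuation x)) →
    (∃ S : Finset K, (↑S : Set K) ⊆ O ∧
      ∀ y : K, y ∈ O → ∃ r : K, r ∈ Subring.closure ((locAtCentre A.toSubring O : Set K) ∪ ↑S) ∧ O.valuation (y - r) < 1) →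
    g₀ ∈ Algebra.adjoin k (Set.range fun y : K => y ^ p) →
    ArcConcl p k K O A g₀ := by
  intro _ k _ _ K _ _ O A hAO hAfg hfrac hdimA hreg hdim3 hzd g₀ hg₀ hdefect htd hdisc _ _
  exact hP k K O A hAO hAfg hfrac hdimA hreg hdim3 hzd g₀ hg₀ hdefect htd hdisc (hD k K A hAfg hfrac g₀ hg₀)

/-- CERTIFICATE: the whole DISCRETE branch of `cleanLU3Defect_of_stubs` (rev 20: a three-way case split over ✓ finite residue /
`stub_cleanLU3DefectArcConstants` / `stub_cleanLU3DefectArcInfinite` / `stub_derivation_of_not_mem_adjoin_pow`) from the TWO targets,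
with no case split at all. [folklore] -/
theorem cleanLU3DefectDiscrete_of_potential_of_absDerivation {p : ℕ} (hP : ArcPotentialAt p) (hD : AbsDerivationMovesAt p) :
    p.Prime →
    ∀ (k : Type) [Field k] [CharP k p] (K : Type) [Field K] [Algebra k K]
    (O : ValuationSubring K) (A : Subalgebra k K), A.toSubring ≤ O.toSubring → A.FG → IsFractionRing A K →
    ringKrullDim A ≤ 3 → IsRegularLocalRing (locAtCentre A.toSubring O) →
    ringKrullDim (locAtCentre A.toSubring O) = 3 →
    (∀ (T : Subring K) (hT : T ≤ O.toSubring), A.toSubring ≤ T → (subringCentre T O hT).IsMaximal) →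
    ∀ g₀ : K, (∀ c : K, c ^ p ≠ g₀) →
    (∀ f₀ : K, ∃ f₁ : K, O.valuation (g₀ - f₁ ^ p) < O.valuation (g₀ - f₀ ^ p)) →
    (∀ hk : ∀ c : k, algebraMap k K c ∈ O, transcendenceDefect k O hk ≠ 0) →
    (∃ π : K, π ≠ 0 ∧ (∀ x : K, O.valuation x < 1 → O.valuation x ≤ O.valuation π) ∧
      (∀ x : K, x ≠ 0 → ∃ n : ℕ, O.valuation π ^ n ≤ O.valuation x)) →
    ArcConcl p k K O A g₀ := by
  intro _ k _ _ K _ _ O A hAO hAfg hfrac hdimA hreg hdim3 hzd g₀ hg₀ hdefect htd hdisc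
  exact hP k K O A hAO hAfg hfrac hdimA hreg hdim3 hzd g₀ hg₀ hdefect htd hdisc (hD k K A hAfg hfrac g₀ hg₀)

/-- LITERALNESS: `ArcConcl` IS the conclusion of the rev-20 stubs — the landed finite-residue theorem proves it as stated.
[folklore] -/
theorem arcConcl_of_landed (p : ℕ) (hp : p.Prime) (k : Type) [Field k] [CharP k p] (K : Type) [Field K] [Algebra k K]
    (O : ValuationSubring K) (A : Subalgebra k K) (hAO : A.toSubring ≤ O.toSubring) (hAfg : A.FG) (hfrac : IsFractionRing A K)
    (hdimA : ringKrullDim A ≤ 3) (hreg : IsRegularLocalRing (locAtCentre A.toSubring O))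
    (hdim3 : ringKrullDim (locAtCentre A.toSubring O) = 3)
    (hzd : ∀ (T : Subring K) (hT : T ≤ O.toSubring), A.toSubring ≤ T → (subringCentre T O hT).IsMaximal)
    (g₀ : K) (hg₀ : ∀ c : K, c ^ p ≠ g₀)
    (hdefect : ∀ f₀ : K, ∃ f₁ : K, O.valuation (g₀ - f₁ ^ p) < O.valuation (g₀ - f₀ ^ p))
    (htd : ∀ hk : ∀ c : k, algebraMap k K c ∈ O, transcendenceDefect k O hk ≠ 0)
    (hdisc : ∃ π : K, π ≠ 0 ∧ (∀ x : K, O.valuation x < 1 → O.valuation x ≤ O.valuation π) ∧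
      (∀ x : K, x ≠ 0 → ∃ n : ℕ, O.valuation π ^ n ≤ O.valuation x))
    (hres : ∃ S : Finset K, (↑S : Set K) ⊆ O ∧
      ∀ y : K, y ∈ O → ∃ r : K, r ∈ Subring.closure ((locAtCentre A.toSubring O : Set K) ∪ ↑S) ∧ O.valuation (y - r) < 1)
    (hder : ∃ (D : Derivation ℤ K K) (s : K), s ≠ 0 ∧ (∀ y : K, y ∈ A → s * D y ∈ A) ∧ D g₀ ≠ 0) :
    ArcConcl p k K O A g₀ :=
  Summit.ResolutionOfSingularities.ResolutionOfSingularities.Theorems.RadicialJung.CleanModels.cleanLU3Defect_of_discrete_of_finiteResidue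
    p hp k K O A hAO hAfg hfrac hdimA hreg hdim3 hzd g₀ hg₀ hdefect htd hdisc hres hder

end Summit.ResolutionOfSingularities.ResolutionOfSingularities.Cruxes.DescentPerfectToAll.CpSibling.ArcPotential
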